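import Mathlib
import Literature.Analysis.FluidPDE.Tao2016AveragedNS.ShiftSetCascadeFlows
import Literature.Analysis.FluidPDE.Tao2016AveragedNS.ShiftSetCascadeFlux
import Summits.NavierStokesRegularity.NavierStokesRegularity.Theorems.TaoLadderRungTwoFlatCertificateGlueSectionReadOn
import Summits.NavierStokesRegularity.NavierStokesRegularity.Theorems.TaoLadderRungTwoFlatCertificateGlueFieldRangeBoxOn
import Summits.NavierStokesRegularity.NavierStokesRegularity.Theorems.TaoLadderRungTwoFlatCertificateGlueCheckerBranchOn
import HarnessLib

/-!
# Certificate glue on a shift set `𝕊`, XXXIII: THE SECTION CHECKER — the section table of a readout step (`p`, `f̂`, `κ`, `Φ`, `W`; global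
  diagonal `q` and level `lev`), its Boolean test `checkSection` (d̂ > 0, κ ≥ |f̂|/d̂, field box about `f̂` within `Φ`, state box about `p`
  within `W`), and `stepRead_of_checks`: `checkGlobal ∧ checkStepBox ∧ checkSection` ⇒ `StepRead` into the box hull `B*` of the section node
  (glue XXXI `stepRead_of_sectionNode` with every analytic hypothesis discharged by glue XXIX, XXXII)
  (helper for items stmt-NavierStokesRegularity-22987 `FlatGapCertificatesV2` (crux K_A♭ of route TaoLadderRungTwoFlat) and stmt-24295 K_A₂(64);
  cell harvest/h2-tao-ladder, p1 g15; theory-1 g25 F-28 and A-74, E3 v0.2 §3)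

HONEST FRAMING: Tao-type MODEL lattices (Tao 2016 §4/§6 vocabulary, shift-set parametrised); soundness of a checker — NO certificate
instance exists in the tree, nothing is certified here, no stub is closed, nothing here is a statement about the Navier–Stokes equations.
-/

-- the sub-problem namespace repeats the summit name by design (D-0017)
set_option linter.dupNamespace false

namespace Summit.NavierStokesRegularity.NavierStokesRegularity.Theorems

open Set Finset Literature.Analysis.FluidPDE Literature.Analysis.FluidPDE.TaoCascade
open Summit.NavierStokesRegularity.NavierStokesRegularity.Theorems.TaylorModelCert
open Summit.NavierStokesRegularity.NavierStokesRegularity.Theorems.TaylorModelReadout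

namespace CertificateGlueOn

/-- **ONE SECTION RECORD** (weighted-coordinate dyadic vectors): the section point `p`, the direction `f̂`, and the claimed bounds `κ ≥ |f̂|/d̂`,
`Φ ≥` field spread about `f̂`, `W ≥` box extent about `p`. [folklore] -/
structure SecRec where
  /-- section point -/
  p : Array Dyad
  /-- projection direction (nominal field at `p`) -/
  f : Array Dyad
  /-- `κ_c ≥ |f_c| / d̂` -/
  κ : Array Dyad
  /-- field spread about `f` on the step box -/
  Φ : Array Dyad
  /-- state-box extent about `p` -/
  W : Array Dyad

variable {m : ℕ} {Kb Ka : ℤ}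

/-- The real diagonal of the section functional from an integer table. [folklore] -/
def qvec {n : ℕ} (qz : Array ℤ) : Fin n → ℝ := fun c => ((qz.getD c 0 : ℤ) : ℝ)

/-- The exact rational transversality denominator `d̂ = Σ_c q_c p_c f_c`. [folklore] -/
def dQ (n : ℕ) (qz : Array ℤ) (p f : Array Dyad) : ℚ :=
  ∑ c : Fin n, ((qz.getD c 0 : ℤ) : ℚ) * dyadToRat (dgetD p c) * dyadToRat (dgetD f c)

/-- `d̂` casts to `secD`. [folklore] -/
theorem cast_dQ (n : ℕ) (qz : Array ℤ) (p f : Array Dyad) :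
    ((dQ n qz p f : ℚ) : ℝ) = secD (qvec (n := n) qz) (dvec (n := n) p) (dvec (n := n) f) := by
  simp only [dQ, secD, secPair, secGrad, qvec, dvec]
  push_cast
  simp only [cast_dyadToRat]

/-- **The section test** of a readout step: `d̂ > 0`; per coordinate `|f_c| ≤ κ_c d̂`, the field box `[Flo_c, Fhi_c]` (interval evaluation over
the step box, widened by the input defect `δ`) is a box with `Fhi_c − f_c ≤ Φ_c`, `f_c − Flo_c ≤ Φ_c`, and `hi_c − p_c ≤ W_c`, `p_c − lo_c ≤ W_c`.
[folklore] -/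
def checkSection (m : ℕ) (Kb Ka : ℤ) (prec : ℕ) (shifts : List (ℤ × ℤ × ℤ))
    (coefB : Fin m → ℤ → Fin m → Fin m → ℤ × ℤ × ℤ → IntervalD) (qz : Array ℤ) (loD hiD : Array Dyad) (δ : Dyad) (s : SecRec) : Bool :=
  let n := m * winLen Kb Ka
  let d := dQ n qz s.p s.f
  decide (0 < d) &&
  (List.finRange n).all fun c =>
    let I := pqBox Kb Ka prec shifts coefB (boxI (n := n) loD hiD) (boxI (n := n) loD hiD) c
    let Flo := dyadToRat I.lo - dyadToRat δ
    let Fhi := dyadToRat I.hi + dyadToRat δ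
    let fc := dyadToRat (dgetD s.f c)
    let pc := dyadToRat (dgetD s.p c)
    decide (|fc| ≤ dyadToRat (dgetD s.κ c) * d) && decide (Flo ≤ Fhi) &&
    decide (Fhi - fc ≤ dyadToRat (dgetD s.Φ c)) && decide (fc - Flo ≤ dyadToRat (dgetD s.Φ c)) &&
    decide (dyadToRat (dgetD hiD c) - pc ≤ dyadToRat (dgetD s.W c)) && decide (pc - dyadToRat (dgetD loD c) ≤ dyadToRat (dgetD s.W c))

/-- **The five analytic hypotheses of glue XXXI `stepRead_of_sectionNode` from the section test.** [folklore] -/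
theorem section_hyps_of_check (hKb : 0 ≤ Kb) (hKa : 1 ≤ Ka) {ωq : Fin m → ℤ → ℚ} (hω : ∀ i k, 0 < ωq i k) {prec : ℕ}
    {shifts : List (ℤ × ℤ × ℤ)} {coefB : Fin m → ℤ → Fin m → Fin m → ℤ × ℤ × ℤ → IntervalD} {qz : Array ℤ} {loD hiD : Array Dyad}
    {δ : Dyad} {s : SecRec} (h : checkSection m Kb Ka prec shifts coefB qz loD hiD δ s = true) :
    let n := m * winLen Kb Ka
    let ω : Fin m → ℤ → ℝ := fun i k => (ωq i k : ℝ)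
    let Flo : Fin n → ℝ := fun d =>
      (pqBox Kb Ka prec shifts coefB (boxI (n := n) loD hiD) (boxI (n := n) loD hiD) d).lo.toReal - δ.toReal
    let Fhi : Fin n → ℝ := fun d =>
      (pqBox Kb Ka prec shifts coefB (boxI (n := n) loD hiD) (boxI (n := n) loD hiD) d).hi.toReal + δ.toReal
    0 < secD (qvec (n := n) qz) (dvec (n := n) s.p) (dvec (n := n) s.f) ∧
    (∀ c, |dvec (n := n) s.f c| ≤ dvec (n := n) s.κ c * secD (qvec (n := n) qz) (dvec (n := n) s.p) (dvec (n := n) s.f)) ∧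
    (∀ c, pxcoord Kb Ka ω (wtab Kb Ka ω Flo) c ≤ pxcoord Kb Ka ω (wtab Kb Ka ω Fhi) c) ∧
    (∀ c, pxcoord Kb Ka ω (wtab Kb Ka ω Fhi) c - dvec (n := n) s.f c ≤ dvec (n := n) s.Φ c ∧
      dvec (n := n) s.f c - pxcoord Kb Ka ω (wtab Kb Ka ω Flo) c ≤ dvec (n := n) s.Φ c) ∧
    (∀ y, InBoxOn Kb Ka (wbox Kb Ka ω loD) (wbox Kb Ka ω hiD) y → ∀ c, |pxcoord Kb Ka ω y c - dvec (n := n) s.p c| ≤ dvec (n := n) s.W c) := by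
  intro n ω Flo Fhi
  have hω' : ∀ i k, 0 < ω i k := fun i k => show (0 : ℝ) < (ωq i k : ℝ) by exact_mod_cast hω i k
  simp only [checkSection, Bool.and_eq_true, decide_eq_true_eq, List.all_eq_true, List.mem_finRange, true_implies] at h
  obtain ⟨hd, hc⟩ := h
  have hdR : (0 : ℝ) < secD (qvec (n := n) qz) (dvec (n := n) s.p) (dvec (n := n) s.f) := by
    rw [← cast_dQ]; exact_mod_cast hd
  refine ⟨hdR, fun c => ?_, fun c => ?_, fun c => ?_, fun y hy c => ?_⟩
  · obtain ⟨⟨⟨⟨⟨h1, -⟩, -⟩, -⟩, -⟩, -⟩ := hc c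
    have h1r := (Rat.cast_le (K := ℝ)).mpr h1
    simp only [Rat.cast_abs, Rat.cast_mul, cast_dyadToRat, cast_dQ] at h1r
    exact h1r
  · obtain ⟨⟨⟨⟨⟨-, h2⟩, -⟩, -⟩, -⟩, -⟩ := hc c
    rw [pxcoord_wtab hKb hKa hω', pxcoord_wtab hKb hKa hω']
    have h2r := (Rat.cast_le (K := ℝ)).mpr h2
    simp only [Rat.cast_sub, Rat.cast_add, cast_dyadToRat] at h2r
    exact h2r
  · obtain ⟨⟨⟨⟨-, h3⟩, h4⟩, -⟩, -⟩ := hc c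
    rw [pxcoord_wtab hKb hKa hω', pxcoord_wtab hKb hKa hω']
    have h3r := (Rat.cast_le (K := ℝ)).mpr h3
    have h4r := (Rat.cast_le (K := ℝ)).mpr h4
    simp only [Rat.cast_sub, Rat.cast_add, cast_dyadToRat] at h3r h4r
    exact ⟨h3r, h4r⟩
  · obtain ⟨⟨-, h5⟩, h6⟩ := hc c
    have h5r := (Rat.cast_le (K := ℝ)).mpr h5
    have h6r := (Rat.cast_le (K := ℝ)).mpr h6
    simp only [Rat.cast_sub, cast_dyadToRat] at h5r h6r
    have hm := mem_boxI_of_inBox hKb hKa hω' hy c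
    simp only [IntervalD.mem, boxI] at hm
    simp only [dvec]
    rw [abs_le]
    constructor <;> linarith [hm.1, hm.2]

/-- **`StepRead` INTO THE SECTION-NODE BOX FROM THE BOOLEANS** `checkGlobal`, `checkStepBox … j` and `checkSection` (section point / direction /
bounds of the readout step `j`; the box, the input defect and the node are those of the step records): every run from `nodeOf rec j` of length
`≤ h j`, read where `sec_q(pxcoord y) = lev`, has `|pxcoord y − x*|_c ≤ Σ_col |C*_{c,col}| r_col + E*_c`.
[cite: Zgliczynski2002C1Lohner, §3–4 (Lohner-type parallelepiped sets; section maps); cell certificate format, section checker] -/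
theorem stepRead_of_checks (hKb : 0 ≤ Kb) (hKa : 1 ≤ Ka) {shifts : List (ℤ × ℤ × ℤ)} (hnd : shifts.Nodup)
    (h𝕊 : IsNearestNeighbourSet shifts.toFinset) {q : ℚ}
    {αq : Fin m → Fin m → Fin m → ℤ × ℤ × ℤ → ℚ} {ωq : Fin m → ℤ → ℚ} (hω : ∀ i k, 0 < ωq i k)
    {prec p kexp nexp : ℕ} {Sp Sm : IntervalD} {bD : Dyad} {Eb Et lev : ℚ} {M : ℤ → ℝ} {rec : ℕ → StepRec} {box : ℕ → BoxRec}
    {qz : Array ℤ} {sr : SecRec} {j : ℕ}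
    (hg : checkGlobal m Kb Ka prec shifts αq ωq q Sp Sm bD = true)
    (hs : checkStepBox m Kb Ka prec p kexp nexp shifts αq ωq Sp Sm bD Eb Et rec box j = true)
    (hsec : checkSection m Kb Ka prec shifts (coefBoxOf prec αq ωq Sp Sm) qz (box j).lo (box j).hi (box j).δ sr = true) :
    let n := m * winLen Kb Ka
    let ω : Fin m → ℤ → ℝ := fun i k => (ωq i k : ℝ)
    StepRead shifts.toFinset (q : ℝ) (fun i₁ i₂ i μ => (αq i₁ i₂ i μ : ℝ)) Kb Ka (Eb : ℝ) (Et : ℝ) M (tOf rec) (nodeOf Kb Ka ωq rec)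
      (fun y => secQ (qvec (n := n) qz) (pxcoord Kb Ka ω y) = (lev : ℝ) →
        ∀ c, |pxcoord Kb Ka ω y c - secCentre (qvec (n := n) qz) (dvec (n := n) sr.p) (dvec (n := n) sr.f)
            (dvec (n := n) (rec j).x) (lev : ℝ) c| ≤
          ∑ col, |secFrame (qvec (n := n) qz) (dvec (n := n) sr.p) (dvec (n := n) sr.f) (dmat (n := n) (rec j).C) c col| *
              dvec (n := n) (rec j).r col +
            secErr (qvec (n := n) qz) (dvec (n := n) sr.p) (dvec (n := n) sr.κ) (fun _ => ((rec j).E₀ : ℝ)) (dvec (n := n) sr.Φ)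
              ((rec j).h : ℝ) (secQmax (qvec (n := n) qz) (dvec (n := n) sr.W)) c) j := by
  intro n ω
  have hg' := hg
  simp only [checkGlobal, Bool.and_eq_true, decide_eq_true_eq, Dyad.ble_iff, Dyad.toReal_ofInt, Int.cast_zero] at hg'
  obtain ⟨⟨⟨⟨hSp, hSm⟩, hq⟩, -⟩, -⟩ := hg'
  have hs' := hs
  simp only [checkStepBox, Bool.and_eq_true, decide_eq_true_eq, Dyad.ble_iff, Dyad.toReal_ofInt, Int.cast_zero] at hs'
  obtain ⟨⟨⟨⟨⟨⟨⟨⟨⟨⟨⟨⟨⟨⟨⟨⟨⟨-, -⟩, -⟩, hAA'⟩, -⟩, -⟩, -⟩, -⟩, -⟩, -⟩, -⟩, -⟩, -⟩, -⟩, h13⟩, -⟩, h11⟩, -⟩ :=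
    hs'
  have hq' : 0 < 1 + (q : ℝ) := by
    have : ((-1 : ℚ) : ℝ) < (q : ℝ) := by exact_mod_cast hq
    push_cast at this; linarith
  have hω' : ∀ i k, (0 : ℝ) < ω i k := fun i k => show (0 : ℝ) < (ωq i k : ℝ) by exact_mod_cast hω i k
  have hcoef := coefBoxOK_coefBoxOf (Kb := Kb) (Ka := Ka) prec hq' αq ωq hSp hSm shifts
  have hstep := stepCert_of_checkStepBox (M := M) hKb hKa hnd h𝕊 hω hg hs
  have hdef := pinputDefect_of_checkDefectT prec hnd h𝕊 hq' hω hSp hSm h11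
  have hrange := fieldRangeOn_of_pqBox (Eb := (Eb : ℝ)) (Et := (Et : ℝ)) hKb hKa hω' hnd hcoef prec hdef
  obtain ⟨hd, hκ, hF, hΦ, hW⟩ := section_hyps_of_check (prec := prec) (shifts := shifts) (coefB := coefBoxOf prec αq ωq Sp Sm) hKb hKa hω hsec
  exact stepRead_of_sectionNode hKb hKa hω' hstep (fun y hy => hy) (fun y hy => inBox_of_hullOfB hnd hω hAA'.le h13 hy) hrange
    (tOf_succ_sub rec j).le hd hκ hF hΦ hW

end CertificateGlueOn

end Summit.NavierStokesRegularity.NavierStokesRegularity.Theorems
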